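import Mathlib.RingTheory.MvPolynomial.Basic
import Mathlib.Algebra.MvPolynomial.CommRing
import Mathlib.RingTheory.Ideal.Maps
import Mathlib.Algebra.CharP.Defs
import HarnessLib

/-!
# The face lemma of the Cartier–Newton toric engine: Fedder's test lifts from an orbit closure
(crux `FInjectiveMacaulayfication`, hole #4 class CN / hole #3 strata; idea-2's `faceFedder_lift`)

[OURS · L1 W4.5a] Support file for crux stmt-ResolutionOfSingularities-15315
(`Summit.ResolutionOfSingularities.ResolutionOfSingularities.Theses.FrobeniusLadder.FInjectiveMacaulayfication`, route
`FrobeniusLadder`, skeleton v11 `86e9127b5c98b8e6`).  Seat table v5 (CRUX-PLAN v5 §5, stub-1 (b)): the first checkable step of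
idea-2's two surviving cards (`cartier-newton-toric-engine` for hole #4 class B1 = CN, `relative-cartier-newton-along-strata` for hole #3;
typed in `L/res-L1-w45a-idea-2/Sketch-L1-idea-2.lean` v2 as `faceFedder_lift`, body `sorry`), PROVED here with the card's
abbreviation `FedderAt p g a := g ^ (p - 1) ∉ ((X_i - a_i) ^ p : i)` unfolded (idea-2's form follows by `Iff.rfl`):

* `faceFedder_lift` — exceptional chart coordinates `Sum.inl`, orbit coordinates `Sum.inr`: if the restriction of `g` to the orbit
  closure `{y = 0}` (the algebra map `yᵢ ↦ 0`, `xⱼ ↦ xⱼ`) passes Fedder's non-membership test `ḡ^(p-1) ∉ ((xⱼ - aⱼ)^p : j)` at the point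
  `a`, then `g` passes it at `(0, a)`: `g^(p-1) ∉ (yᵢ^p, (xⱼ - aⱼ)^p : i, j)`.  Proof: reduction modulo `(y)` is a ring map sending the
  Frobenius power of the maximal ideal at `(0, a)` into the one at `a` (`yᵢ^p ↦ 0`, `(xⱼ - aⱼ)^p ↦ (xⱼ - aⱼ)^p`) and `g^(p-1)` to `ḡ^(p-1)`.
* `faceFedder_lift'` — the same with the restriction written as `MvPolynomial.aeval (Sum.elim 0 X)` applied inside (idea-2's literal
  binder shape).

Folklore; no definition is declared; AI-written, weaker than expert review; no statement of [claim: Hironaka2017] is used.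
[cite: Fedder1983, Prop. 1.7 (the test being transported)]
-/

-- single-problem summit: the doubled namespace component is forced
set_option linter.dupNamespace false

noncomputable section

namespace Summit.ResolutionOfSingularities.ResolutionOfSingularities.Theorems.FInjectiveMacaulayfication.FaceFedderLift

open MvPolynomial

/-- **Fedder's test lifts from the orbit closure `{y = 0}` to the point `(0, a)`.**  For `g ∈ K[yᵢ, xⱼ]` (`i : Fin r` exceptional,
`j : Fin s` orbit coordinates), `a : Fin s → K` and `p ≠ 0`: if `ḡ^(p-1) ∉ ((xⱼ - aⱼ)^p : j)` for `ḡ = g(0, x)`, then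
`g^(p-1) ∉ ((Xᵢ - cᵢ)^p : i)` with `c = (0, a)`. [folklore] -/
theorem faceFedder_lift (p : ℕ) (hp : p ≠ 0) {K : Type} [Field K] {r s : ℕ}
    (g : MvPolynomial (Fin r ⊕ Fin s) K) (a : Fin s → K)
    (h : (aeval (Sum.elim (fun _ : Fin r => (0 : MvPolynomial (Fin s) K)) (fun j : Fin s => X j)) g) ^ (p - 1) ∉
      Ideal.span (Set.range fun j : Fin s => (X j - C (a j)) ^ p)) :
    g ^ (p - 1) ∉ Ideal.span (Set.range fun i : Fin r ⊕ Fin s =>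
      (X i - C (Sum.elim (fun _ : Fin r => (0 : K)) a i)) ^ p) := by
  intro hmem
  apply h
  -- the reduction map `yᵢ ↦ 0`, `xⱼ ↦ xⱼ`
  set φ : MvPolynomial (Fin r ⊕ Fin s) K →ₐ[K] MvPolynomial (Fin s) K :=
    aeval (Sum.elim (fun _ : Fin r => (0 : MvPolynomial (Fin s) K)) (fun j : Fin s => X j)) with hφ
  -- it maps the Frobenius power at `(0, a)` into the Frobenius power at `a`
  have himg : (Ideal.span (Set.range fun i : Fin r ⊕ Fin s =>
      (X i - C (Sum.elim (fun _ : Fin r => (0 : K)) a i)) ^ p)).map φ ≤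
      Ideal.span (Set.range fun j : Fin s => (X j - C (a j)) ^ p) := by
    rw [Ideal.map_span]
    refine Ideal.span_le.mpr ?_
    rintro _ ⟨_, ⟨i, rfl⟩, rfl⟩
    rcases i with i | j
    · -- `φ ((yᵢ - 0)^p) = 0`
      have e : φ ((X (Sum.inl i) - C (Sum.elim (fun _ : Fin r => (0 : K)) a (Sum.inl i))) ^ p) = 0 := by
        rw [map_pow, map_sub, hφ, aeval_X, aeval_C, Sum.elim_inl, Sum.elim_inl, map_zero, sub_zero, zero_pow hp]
      rw [e]
      exact Ideal.zero_mem _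
    · -- `φ ((xⱼ - aⱼ)^p) = (xⱼ - aⱼ)^p`
      have e : φ ((X (Sum.inr j) - C (Sum.elim (fun _ : Fin r => (0 : K)) a (Sum.inr j))) ^ p) = (X j - C (a j)) ^ p := by
        rw [map_pow, map_sub, hφ, aeval_X, aeval_C, Sum.elim_inr, Sum.elim_inr]
        rfl
      rw [e]
      exact Ideal.subset_span ⟨j, rfl⟩
  have h1 : φ (g ^ (p - 1)) ∈ Ideal.span (Set.range fun j : Fin s => (X j - C (a j)) ^ p) :=
    himg (Ideal.mem_map_of_mem φ hmem)
  rwa [map_pow] at h1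

/-- The same statement with `p` read off a `Fact p.Prime` instance (idea-2's binder shape; `K` of any characteristic — the
characteristic plays no role in the transport). [folklore] -/
theorem faceFedder_lift' (p : ℕ) [hp : Fact p.Prime] {K : Type} [Field K] {r s : ℕ}
    (g : MvPolynomial (Fin r ⊕ Fin s) K) (a : Fin s → K)
    (h : (aeval (Sum.elim (fun _ : Fin r => (0 : MvPolynomial (Fin s) K)) (fun j : Fin s => X j)) g) ^ (p - 1) ∉
      Ideal.span (Set.range fun j : Fin s => (X j - C (a j)) ^ p)) :
    g ^ (p - 1) ∉ Ideal.span (Set.range fun i : Fin r ⊕ Fin s =>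
      (X i - C (Sum.elim (fun _ : Fin r => (0 : K)) a i)) ^ p) :=
  faceFedder_lift p hp.out.ne_zero g a h

end Summit.ResolutionOfSingularities.ResolutionOfSingularities.Theorems.FInjectiveMacaulayfication.FaceFedderLift

end
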